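import Mathlib
import HarnessLib
import Summits.ValiantsHypothesis.ValiantsHypothesis.Theorems.MonotoneRestorationMonotoneRestorationQPLinearWidthAffineWitness
import Literature.Combinatorics.SimpleGraph.WallTopologicalMinor
import Literature.Combinatorics.SimpleGraph.SubcubicMinors

/-!
# Route MonotoneRestoration, crux `MonotoneRestorationQP` (stmt-15886), line `linear_width` —
# THE `√N` RUNG FROM THE EXCLUDED-GRID THEOREM AND ONE RE-EMBEDDING LEMMA (census g14, kernel-pinned)

Helper file (`--supports stmt-ValiantsHypothesis-15886`), def-free.  Companion of `…LinearWidthAffineWitness` (p841762).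

The affine witnesses reduce the `√N` rung `WidthRung (fun n => Nat.sqrt n / (3C+3))` to (SUB₂)_{C,g}: every wide bipartite
pattern contains the 2-subdivision `subdiv B` of a connected wide base `B` as a SUBGRAPH, `|CFI(B)| ≤ C(a+b+1)`.  This file
pins the two remaining inputs as exact hypotheses and assembles them:

* **(GM)_{gm}** — the Excluded Grid Theorem, as a function `gm` with `gm r ≤ tw F ⇒ grid r r ≼ₘ F` for every finite graph `F`
  (Chekuri–Chuzhoy 2016 / Chuzhoy–Tan 2021: `gm r = O(r⁹ polylog r)`; in the tree only as an explicit hypothesis, cf.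
  `Literature/Combinatorics/SimpleGraph/WallTopologicalMinor.lean`); by the tree's `wall_isTopologicalMinor_of_grid_isMinor`
  it yields the wall `W_r` as a TOPOLOGICAL minor, i.e. a subdivided wall as a subgraph;
* **(RE)_c** — re-embedding: a graph containing a subdivision of the wall `W_{c·r}` contains `subdiv B` as a subgraph for a
  connected base `B` on `≥ 2` and at most `|V(F)|` vertices, with an edge, `tw B ≥ r` and `|CFI(B)| ≤ 14·|V(B)|` (the bound
  `card_cfiVertex_le` gives for subcubic bases) — elementary (route the edges of a coarser wall as segments of length exactly `3`,
  fixing residues mod `3` by detours), not in the tree.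

Results: `pow_affine_le_pow_mul` (`(c·k+2)^e ≤ (k+2)^{c·e}` for `c ≥ 1`), `sub2_of_gridMinor_of_reembedding`
((GM)_{gm} ∧ (RE)_c ⇒ (SUB₂)_{14, gm ∘ (c·)}), and **`widthRung_sqrt_of_gridMinor_of_reembedding`**:
(GM)_{gm} with `gm r ≤ (r+2)^e`, and (RE)_c, imply `WidthRung (fun n => Nat.sqrt n / 45)`.

Honest label: conditional assembly; (GM) is a theorem in print (to be typed by name), (RE) is owed.  No stub closed; θ₁ (linear
degree), the cruxes and VP ≠ VNP NOT moved. [cite: ChuzhoyTan2021, Thm 1.1; GalesiEtAl2023, Cor. 9; DawarPagoSeppelt2025, §7]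
-/

set_option linter.dupNamespace false

noncomputable section

open scoped Classical

namespace Summit.ValiantsHypothesis.ValiantsHypothesis.Theorems.AffineWitness

open MvPolynomial
open Literature.ModelTheory.FiniteModelTheory Literature.ModelTheory.FiniteModelTheory.ChenFlumLiu2025
open Literature.Computability.AlgebraicComplexity
open Literature.Combinatorics.SimpleGraph
open Summit.ValiantsHypothesis.ValiantsHypothesis.Theorems.MonotoneRestorationQPLinearWidth
open Summit.ValiantsHypothesis.ValiantsHypothesis.Theorems.CFIHomMonotone

/-- `c·k + 2 ≤ (k+2)^c` for `c ≥ 1` (Bernoulli). [folklore] -/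
theorem affine_le_pow {c : ℕ} (hc : 1 ≤ c) (k : ℕ) : c * k + 2 ≤ (k + 2) ^ c := by
  induction c, hc using Nat.le_induction with
  | base => simp
  | succ c hc ih =>
    rw [pow_succ]
    have h1 : (c * k + 2) * (k + 2) ≤ (k + 2) ^ c * (k + 2) := Nat.mul_le_mul_right _ ih
    have h2 : (c + 1) * k + 2 ≤ (c * k + 2) * (k + 2) := by
      nlinarith [Nat.zero_le (c * k * k), Nat.zero_le (c * k), Nat.zero_le k]
    exact h2.trans h1

/-- `(c·k + 2)^e ≤ (k+2)^{c·e}` for `c ≥ 1`: a polynomial bound stays polynomial after a linear change of variable. [folklore] -/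
theorem pow_affine_le_pow_mul {c : ℕ} (hc : 1 ≤ c) (k e : ℕ) : (c * k + 2) ^ e ≤ (k + 2) ^ (c * e) := by
  rw [pow_mul]
  exact Nat.pow_le_pow_left (affine_le_pow hc k) e

/-- **(GM) ∧ (RE) ⇒ (SUB₂)_{14, gm(c·k)}**: a grid minor (excluded-grid theorem) gives a topological wall minor
(`wall_isTopologicalMinor_of_grid_isMinor`), the re-embedding lemma turns it into a 2-subdivided wide base contained as a
subgraph, of CFI-size `≤ 14·(a+b)`. [cite: GalesiEtAl2023, Cor. 9; ChuzhoyTan2021, Thm 1.1] -/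
theorem sub2_of_gridMinor_of_reembedding (gm : ℕ → ℕ) (c : ℕ)
    (hGM : ∀ (r : ℕ) {V : Type} [Fintype V] (F : SimpleGraph V),
      gm r ≤ Literature.Combinatorics.SimpleGraph.treewidth F → grid r r ≼ₘ F)
    (hRE : ∀ (r : ℕ) {V : Type} [Fintype V] (F : SimpleGraph V), 1 ≤ r → wall (c * r) ≼ₜ F →
      ∃ (v : ℕ) (B : SimpleGraph (Fin v)), B.Connected ∧ 2 ≤ v ∧
        r ≤ Literature.Combinatorics.SimpleGraph.treewidth B ∧ B.edgeSet.Nonempty ∧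
        v ≤ Fintype.card V ∧ Fintype.card (CFIVertex B) ≤ 14 * v ∧
        ∃ σ : subdiv B →g F, Function.Injective σ) :
    ∀ (k a b : ℕ) (E : Multiset (Fin a × Fin b)), 1 ≤ k →
      (∀ u : Fin a, ∃ x ∈ E, x.1 = u) → (∀ w : Fin b, ∃ x ∈ E, x.2 = w) →
      gm (c * k) ≤ Literature.Combinatorics.SimpleGraph.treewidth (patternGraph E) →
      ∃ (v : ℕ) (B : SimpleGraph (Fin v)), B.Connected ∧ 2 ≤ v ∧
        k ≤ Literature.Combinatorics.SimpleGraph.treewidth B ∧ B.edgeSet.Nonempty ∧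
        Fintype.card (CFIVertex B) ≤ 14 * (a + b + 1) ∧
        ∃ σ : subdiv B →g patternGraph E, Function.Injective σ := by
  intro k a b E hk _ _ htw
  obtain ⟨v, B, hconn, h2, htwB, hE, hv, hcard, σ, hσ⟩ :=
    hRE k (patternGraph E) hk (wall_isTopologicalMinor_of_grid_isMinor (hGM (c * k) (patternGraph E) htw))
  refine ⟨v, B, hconn, h2, htwB, hE, hcard.trans ?_, σ, hσ⟩
  have : Fintype.card (Fin a ⊕ Fin b) = a + b := by simp
  rw [this] at hv
  omega

/-- **THE `√N` RUNG FROM (GM) + (RE).**  If the Excluded Grid Theorem holds with a polynomial bound `gm r ≤ (r+2)^e` and the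
re-embedding lemma (RE)_c holds for some `c ≥ 1`, then `WidthRung (fun n => Nat.sqrt n / 45)`: every matrix-symmetric `VP`
family of degree `≤ √n/45` that is `PolylogHomDetermined` has square-symmetric circuits of quasi-polynomial orbit size.
[cite: ChuzhoyTan2021, Thm 1.1; DawarPagoSeppelt2025, Thm 7.3, Thm 7.9; DawarWilsenach2025, §3.3] -/
theorem widthRung_sqrt_of_gridMinor_of_reembedding (gm : ℕ → ℕ) (e c : ℕ) (hc : 1 ≤ c)
    (hgm : ∀ r, gm r ≤ (r + 2) ^ e)
    (hGM : ∀ (r : ℕ) {V : Type} [Fintype V] (F : SimpleGraph V),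
      gm r ≤ Literature.Combinatorics.SimpleGraph.treewidth F → grid r r ≼ₘ F)
    (hRE : ∀ (r : ℕ) {V : Type} [Fintype V] (F : SimpleGraph V), 1 ≤ r → wall (c * r) ≼ₜ F →
      ∃ (v : ℕ) (B : SimpleGraph (Fin v)), B.Connected ∧ 2 ≤ v ∧
        r ≤ Literature.Combinatorics.SimpleGraph.treewidth B ∧ B.edgeSet.Nonempty ∧
        v ≤ Fintype.card V ∧ Fintype.card (CFIVertex B) ≤ 14 * v ∧
        ∃ σ : subdiv B →g F, Function.Injective σ) :
    WidthRung fun n => Nat.sqrt n / 45 := by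
  have h := widthRung_sqrt_of_subdivisions 14 (fun k => gm (c * k)) (c * e)
    (fun k => (hgm (c * k)).trans (pow_affine_le_pow_mul hc k e))
    (sub2_of_gridMinor_of_reembedding gm c hGM hRE)
  simpa using h

end Summit.ValiantsHypothesis.ValiantsHypothesis.Theorems.AffineWitness

end
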